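import Literature.Geometry.Kaehler.DolbeaultLerayBanach
import Literature.Geometry.Kaehler.HolomorphicLineBundle
import Literature.Geometry.Manifold.ChartShrink
import HarnessLib

/-!
# Nested Leray data subordinate to a cover: transport along shrunk charts

Layer `Literature/Geometry/Kaehler`. The tree's nested Leray data of a compact manifold
(`DolbeaultLerayDatum E M`, `nonempty_dolbeaultLerayDatum`: four nested finite covers by chart-convex
sets, `DolbeaultLerayBanach`) have members inside CHART SOURCES. Running the same construction on the
manifold with charts shrunk into prescribed open neighbourhoods `V_x` (`ChartShrink 𝒱`,
`Literature/Geometry/Manifold/ChartShrink`) and transporting the datum back to `M`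
(`DolbeaultLerayDatum.ofChartShrink`: same sets, same centres, same convex chart pieces — a chart set
of a shrunk chart is the chart set of the original chart, `ChartShrink.chartSet_eq`) gives Leray data
all of whose members lie in the neighbourhoods `V` of their centres (`ofChartShrink_U_subset`). In
particular (`HolomorphicLineBundle.exists_dolbeaultLerayDatum_subordinate`): **for every holomorphic
line cocycle `L` on a compact complex manifold and every auxiliary assignment of open neighbourhoods
`𝒲` there are nested Leray data subordinate to the trivialisation of `L` (through a frame map) and to
`𝒲`** — the data on which the twisted Cartan–Serre theorem `finite_cohomology_oneL` operates.

Everything is proved; the only definition is the transport `ofChartShrink`.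

## References

* H. Grauert, R. Remmert, *Theorie der Steinschen Räume* (1977), Kap. VI §4.1 (Meßatlanten
  subordinate to a Stein cover). [GrauertRemmert1977]
* J. M. Lee, *Introduction to Smooth Manifolds* (2013), Lemma 1.35. [Lee2013]
-/

noncomputable section

open scoped Manifold ContDiff Topology
open Set Filter Function Literature.Geometry.Manifold

namespace Literature.Geometry.Kaehler

variable {ι : Type*} {E : Type*} [NormedAddCommGroup E] [NormedSpace ℂ E]
  {M : Type*} [TopologicalSpace M] [ChartedSpace E M]

/-! ### Chart sets of shrunk charts -/

/-- **A chart set of a shrunk chart is the chart set of the original chart** (for a piece `C`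
inside the target of the shrunk extended chart: the two charts have the same map, and a point of the
original source charted into `C` lies in the shrunk source). [cite: Lee2013, Ch. 1, Lemma 1.35] -/
theorem _root_.Literature.Geometry.Manifold.ChartShrink.chartSet_eq (𝒱 : OpenNhdFamily M) (p : M) {C : Set E}
    (hC : C ⊆ (extChartAt (M := ChartShrink 𝒱) 𝓘(ℝ, E) p).target) :
    chartSet (M := ChartShrink 𝒱) 𝓘(ℝ, E) p C = chartSet (M := M) 𝓘(ℝ, E) p C := by
  refine Set.ext fun x ↦ ⟨fun hx ↦ ?_, fun hx ↦ ?_⟩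
  · obtain ⟨hs, hC'⟩ := (mem_chartSet_iff (M := ChartShrink 𝒱)).1 hx
    rw [ChartShrink.extChartAt_source] at hs
    exact (mem_chartSet_iff (M := M)).2 ⟨hs.1, hC'⟩
  · obtain ⟨hs, hC'⟩ := (mem_chartSet_iff (M := M)).1 hx
    have h : (extChartAt 𝓘(ℝ, E) p).symm (extChartAt 𝓘(ℝ, E) p x) ∈
        (extChartAt 𝓘(ℝ, E) p).source ∩ 𝒱.V p := by
      have h' := (extChartAt (M := ChartShrink 𝒱) 𝓘(ℝ, E) p).map_target (hC hC')
      rw [ChartShrink.extChartAt_source] at h'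
      exact h'
    rw [(extChartAt 𝓘(ℝ, E) p).left_inv hs] at h
    refine (mem_chartSet_iff (M := ChartShrink 𝒱)).2 ⟨?_, hC'⟩
    rw [ChartShrink.extChartAt_source]
    exact h

namespace DolbeaultLerayDatum

/-! ### Transport of Leray data along shrunk charts -/

/-- **Transport of nested Leray data from `ChartShrink 𝒱` to `M`**: the same covers, centres and
convex chart pieces (the chart pieces lie in the original chart targets, and the chart sets agree).
[cite: GrauertRemmert1977, Kap. VI §4.1] -/
def ofChartShrink (𝒱 : OpenNhdFamily M) (D : DolbeaultLerayDatum E (ChartShrink 𝒱)) : DolbeaultLerayDatum E M where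
  s := D.s
  U := D.U
  isOpen := D.isOpen
  cover := D.cover
  mono := D.mono
  closure_subset := D.closure_subset
  ctr := D.ctr
  C := D.C
  C_open := D.C_open
  C_convex := D.C_convex
  C_subset a J l := (D.C_subset a J l).trans (ChartShrink.extChartAt_target_subset 𝒱 𝓘(ℝ, E) _)
  cechSet_eq a J l := (D.cechSet_eq a J l).trans (ChartShrink.chartSet_eq 𝒱 _ (D.C_subset a J l))

/-- The covers of the transported datum (definitional). [folklore] -/
@[simp]
theorem ofChartShrink_U (𝒱 : OpenNhdFamily M) (D : DolbeaultLerayDatum E (ChartShrink 𝒱)) :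
    (ofChartShrink 𝒱 D).U = D.U :=
  rfl

/-- The centres of the transported datum (definitional). [folklore] -/
@[simp]
theorem ofChartShrink_ctr (𝒱 : OpenNhdFamily M) (D : DolbeaultLerayDatum E (ChartShrink 𝒱)) :
    (ofChartShrink 𝒱 D).ctr = D.ctr :=
  rfl

/-- **The members of Leray data built on shrunk charts are subordinate to the neighbourhoods of
their centres**: `U_{l,i} ⊆ V_{ctr (i)}` at every level (a chart set lies in the chart source, which
was shrunk into `V`). [cite: GrauertRemmert1977, Kap. VI §4.1] -/
theorem U_subset_V_ctr (𝒱 : OpenNhdFamily M) (D : DolbeaultLerayDatum E (ChartShrink 𝒱)) (l : Fin 4) (i : ↥D.s) :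
    D.U l i ⊆ 𝒱.V (D.ctr 0 ![i]) := by
  intro x hx
  have hx' : x ∈ cechSet (D.U l) ![i] := by
    rw [cechSet_fin_one]
    exact hx
  rw [D.cechSet_eq 0 ![i] l] at hx'
  have hsrc := chartSet_subset_source (M := ChartShrink 𝒱) 𝓘(ℝ, E) _ _ hx'
  rw [extChartAt_source] at hsrc
  exact ChartShrink.chartAt_source_subset 𝒱 _ hsrc

end DolbeaultLerayDatum

/-! ### Leray data subordinate to a line cocycle -/

/-- **Compact complex manifolds carry nested Leray data subordinate to the trivialisation of any
holomorphic line cocycle `L` and to any auxiliary open neighbourhoods `𝒲`**: there are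
`D : DolbeaultLerayDatum E M` and a frame map `fr` with `U_{3,i} ⊆ U_{fr i}` (hence all levels lie in
trivialising sets) and `U_{3,i} ⊆ W_x` for some `x`, for every `i` (the Leray data of the manifold with
charts shrunk into `U_{a(x)} ∩ W_x`, transported back). [cite: GrauertRemmert1977, Kap. VI §4.1] -/
theorem HolomorphicLineBundle.exists_dolbeaultLerayDatum_subordinate [FiniteDimensional ℂ E] [T2Space M]
    [CompactSpace M] [IsManifold 𝓘(ℝ, E) ∞ M] (L : HolomorphicLineBundle ι E M) (𝒲 : OpenNhdFamily M) :
    ∃ (D : DolbeaultLerayDatum E M) (fr : ↥D.s → ι),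
      (∀ i, D.U 3 i ⊆ L.baseSet (fr i)) ∧ ∀ i, ∃ x, D.U 3 i ⊆ 𝒲.V x := by
  choose a ha using L.exists_mem_baseSet
  set 𝒱 : OpenNhdFamily M := (OpenNhdFamily.ofCover L.baseSet L.isOpen_baseSet a ha).inter 𝒲 with h𝒱
  obtain ⟨D'⟩ := nonempty_dolbeaultLerayDatum (E := E) (M := ChartShrink 𝒱)
  refine ⟨DolbeaultLerayDatum.ofChartShrink 𝒱 D', fun i ↦ a (D'.ctr 0 ![i]), fun i ↦ ?_, fun i ↦ ⟨D'.ctr 0 ![i], ?_⟩⟩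
  · exact (D'.U_subset_V_ctr 𝒱 3 i).trans inter_subset_left
  · exact (D'.U_subset_V_ctr 𝒱 3 i).trans inter_subset_right

end Literature.Geometry.Kaehler
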